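import Mathlib
import Summits.KontsevichZagierPeriods.Zeta5Search.ProfileA6u7CellsA
import Summits.KontsevichZagierPeriods.Zeta5Search.ProfileA6u7CellsB
import Summits.KontsevichZagierPeriods.Zeta5Search.ProfileA6u67CellsA
import Summits.KontsevichZagierPeriods.Zeta5Search.ProfileA6u67CellsB
import Summits.KontsevichZagierPeriods.Zeta5Search.DenomLaw.Profile15aPath
import Summits.KontsevichZagierPeriods.Zeta5Search.DenomLaw.PathWeightProfile
import Summits.KontsevichZagierPeriods.Zeta5Search.DenomLaw.VGainCoverKit
import Summits.KontsevichZagierPeriods.Zeta5Search.DenomLaw.Profile6PathA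
import Summits.KontsevichZagierPeriods.Zeta5Search.DenomLaw.Profile7PathA
import HarnessLib

/-!
# ζ(5) search — the FIRST a < 7 PROFILES: six long parameters, long pair blocks `(i,7)` resp. `(i,7),(5,6)`, for EVERY sorted parameter vector at depth `d < 2p` (DENOM-LAW D1, prover-d1 gen 23)

Cell `pub-zeta5` (HONEST FRAMING: systematic search; no irrationality claim unless certified), TRACK «DENOM-LAW» D1 prover seat (denom-prover-d1
gen 23, `HOME/denom-law/prover-d1/ATTEMPT-23.md`).  After the a = 7 assembly (`ProfileA7Assembly`) the node `DenomLaw.PathAccountingFirstPeriod`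
is open exactly on the a < 7 regime (some parameter below `p`; 83 % of the first-period instances at p = 7).  This file opens it with the two largest
profiles of the a = 6 stratum (`b₇ < p ≤ b₆`): A6U7 = long pair blocks exactly the `(i,7)` (ORDER conditions `p + b₁ + b₇ ≤ b₀`, `b₀ < p + b₅ + b₆`;
7,427 of the 26,431 a = 6 instances at p = 7) and A6U67 = the `(i,7)` and `(5,6)` (`p + b₁ + b₇ ≤ b₀`, `p + b₅ + b₆ ≤ b₀`, `b₀ < p + b₄ + b₆`; 2,307).
New feature of a < 7 covers: classes may START inside the largest block (type vectors beginning with `0`; 44 + 2 new leaf lemmas in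
`ProfileA6u7Cells{A,B}`, machine-generated by gen 17/18's generator with the stratum constraint `b₇ < p ≤ b₆`).  On both profiles the minimum
`VB = −6` of `ν` over the pole types is carried only by the centre-free palindromic single `[0,−6,0]`; so gen 23's V-GAIN COVER KIT
(`DenomLaw/VGainCoverKit`, `N = 6`, `R = 1`; `checkB` and the multipole-row check `decide`d on the whole type lists) gives `v_p(Cas_j(b)) ≥ −5 + [p ≤ d]`,
which IS the node at `⌊d/p⌋ ≤ 1` (`N_p = 6`, `C⋆ ≤ 6`, resp. `N_p = 7`, `C⋆ ≤ 7` — new finite checks with SIX long interior vertices at most five of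
which fit; the pair-digit lemmas are gen 22's `pairFloors_eq_6b` / `pairFloors_eq_7a`, whose pair profiles coincide with A6U7 / A6U67 — the stratum plays no
role in `N_p`).  The depth `⌊d/p⌋ = 2` (181 of the 9,734 instances at p = 7; node `−3`, reached in the census by (CV+) and the ZERO-V rungs) is left
open: the theorems carry `d < 2p`.  p-UNIFORM hypotheses (lead l.9565): stratum + ORDER conditions + depth only; the covers are complete for every
`p`.  Results: `pathAccounting_profileA6u7 / A6u67` (every `j`) and `pathAccountingFirstPeriod_profileA6u7 / A6u67`.
MODEL/structure-side valuation bookkeeping of the cell's own rationals; nothing about ζ(5); no γ; records in print UNMOVED.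
-/

open Finset

namespace Summit.KontsevichZagierPeriods.Zeta5Search.FullProfile

open Summit.KontsevichZagierPeriods.Zeta5Search.ClusterValuation
open Summit.KontsevichZagierPeriods.Zeta5Search.CasoratianValuation (InPolytope shift casoratian pairFloors refund)
open Summit.KontsevichZagierPeriods.Zeta5Search.WedgeDictionary (dOf)
open Summit.KontsevichZagierPeriods.Zeta5Search.ClassTypeCover
open Summit.KontsevichZagierPeriods.Zeta5Search.DenomLaw (cStar FirstPeriod Sorted7 vgain_of_cover)
open Summit.KontsevichZagierPeriods.Zeta5Search.DenomLaw.FirstPeriodKit (sorted7_chain firstPeriod_pair pairFloors_expand)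
open Summit.KontsevichZagierPeriods.Zeta5Search.SortedProfile

/-! ## The a = 6 profile with long pair blocks `(i,7)`, `i ≤ 6` -/

section A6U7

variable {b : ℕ → ℤ} {j p : ℕ}

/-- **`C⋆ ≤ 6` on this profile** (six long parameters; long pair blocks `(i,7)`, `i ≤ 6`): the finite check over the 5,040 orderings (`decide +kernel`). -/
theorem cStar_le_six_A6u7 {b : ℕ → ℤ} {p : ℕ} (hs : Sorted7 b) (hA : b 7 < (p : ℤ)) (hQ : b 0 < (p : ℤ) + b 5 + b 6) : cStar b p ≤ 6 := by
  obtain ⟨h21, h32, h43, h54, h65, h76⟩ := sorted7_chain hs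
  refine DenomLaw.FirstPeriodKit.cStar_le_of_profile (fun i => i.val ≤ 5)
    (fun i k => ¬ ((i.val ≤ 5 ∧ k.val ≤ 5) ∧ i.val ≠ k.val)) 6 ?_ ?_ (by decide +kernel)
  · intro i h
    have := i.isLt
    by_contra hc
    have h6 : i.val = 6 := by omega
    have : b (i.val + 1) = b 7 := by rw [h6]
    linarith
  · intro i k hik h
    obtain ⟨⟨hi, hk⟩, hne⟩ := h
    have := i.isLt; have := k.isLt
    exfalso
    interval_cases hv : i.val <;> interval_cases hw : k.val <;> simp only [Nat.reduceAdd] at hik <;> omega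

/-- **The V-GAIN law on this profile, general `b`, every depth**: `v_p(Cas_j(b)) ≥ −5`, and `≥ −4` for `p ≤ d` — the minimum `VB = −6` of
`ν` over the cover's pole types is carried ONLY by the centre-free palindromic single-pole type `[0,−6,0]` (exponent `−6`, even), every other
pole type has `ν ≥ −5`, and the multipole types have `E ≥ −2` (gen 10's `checkB` at `N = 6` and the row check, `decide`d on the whole type lists);
gen 23's `DenomLaw.vgain_of_cover` (pairwise cancellation of the carriers' constant terms for `b` AND `b + e_j`, THEOREM LB's rows). -/
theorem cas_geA6u7 (hb : InPolytope b) (hs : Sorted7 b) (hbj : InPolytope (shift b j)) (hj1 : 1 ≤ j) (hj7 : j ≤ 7)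
    (hprime : p.Prime) (hp5 : 5 ≤ p) (hwin : (b 0 + 2 : ℤ) < (p : ℤ) ^ 2) (hA : b 7 < (p : ℤ)) (hA6 : (p : ℤ) ≤ b 6) (hQ : b 0 < (p : ℤ) + b 5 + b 6) (hQ17 : (p : ℤ) + b 1 + b 7 ≤ b 0)
    (hF1 : b 1 < 2 * (p : ℤ)) (hF2 : b 0 < 2 * (p : ℤ) + b 6 + b 7) (hcas : casoratian b j ≠ 0) :
    -5 + (if (p : ℤ) ≤ dOf b then (1 : ℤ) else 0) ≤ padicValRat p (casoratian b j) := by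
  haveI : Fact p.Prime := ⟨hprime⟩
  have hp2 : p % 2 = 1 := Nat.odd_iff.1 (hprime.odd_of_ne_two (by omega))
  obtain ⟨h21, h32, h43, h54, h65, h76⟩ := sorted7_chain hs
  obtain ⟨h0, hb1, hb2, hb3, hb4, hb5, hb6, hb7, hc1⟩ := box hb
  have hpb : (p : ℤ) ≤ b 0 := by linarith
  have hmin : min (1 : ℤ) 0 = 0 := by norm_num
  rcases Int.emod_two_eq_zero_or_one (b 0) with hr | hr
  · have h := vgain_of_cover hb hj1 hj7 hbj hp5 hpb hwin (coverA6u7_ev hb hs hA hA6 hQ hQ17 hF1 hF2 hp5 hp2 hr) (N := 6) (by norm_num) ⟨3, rfl⟩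
      (by rw [oddFlag_false hr]; decide) 1 le_rfl (by rw [oddFlag_false hr]; decide) hcas
    rw [hmin] at h; push_cast at h; linarith
  · have h := vgain_of_cover hb hj1 hj7 hbj hp5 hpb hwin (coverA6u7_od hb hs hA hA6 hQ hQ17 hF1 hF2 hp5 hp2 hr) (N := 6) (by norm_num) ⟨3, rfl⟩
      (by rw [oddFlag_true hr]; decide) 1 le_rfl (by rw [oddFlag_true hr]; decide) hcas
    rw [hmin] at h; push_cast at h; linarith

/-- **`PathAccountingFirstPeriod`'s conclusion on this a = 6 profile (long pair blocks `(i,7)`, `i ≤ 6`), EVERY sorted `b`, every direction `j`, depth `d < 2p`**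
(`N_p = 6`, `C⋆ ≤ 6`; the node asks `-5` at `⌊d/p⌋ = 0` and `-4` at `⌊d/p⌋ = 1`; the depth `⌊d/p⌋ = 2` — 145 resp. 36 of the 7,427 resp. 2,307 instances
at p = 7 — is NOT covered here: there the node asks `−3` and the census reaches it by (CV+) / the ZERO-V rungs). -/
theorem pathAccounting_profileA6u7 (b : ℕ → ℤ) (j p : ℕ) (hb : InPolytope b) (hs : Sorted7 b) (hbj : InPolytope (shift b j))
    (hj1 : 1 ≤ j) (hj7 : j ≤ 7) (hprime : p.Prime) (hp5 : 5 ≤ p) (hwin : (b 0 + 2 : ℤ) < (p : ℤ) ^ 2) (hfp : FirstPeriod b p)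
    (hA : b 7 < (p : ℤ)) (hA6 : (p : ℤ) ≤ b 6) (hQ : b 0 < (p : ℤ) + b 5 + b 6) (hQ17 : (p : ℤ) + b 1 + b 7 ≤ b 0) (hd2 : dOf b < 2 * (p : ℤ))
    (hcas : casoratian b j ≠ 0) :
    dOf b / (p : ℤ) - pairFloors b p - min (if 2 ≤ dOf b / (p : ℤ) then (1 : ℤ) else 0) (5 - (cStar b p : ℤ))
      ≤ padicValRat p (casoratian b j) := by
  obtain ⟨hF1, hF2⟩ := fp_bounds hfp
  have hp0 : (0 : ℤ) < p := by exact_mod_cast hprime.pos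
  rw [pairFloors_eq_6b hb hs hprime.pos hQ hQ17 hfp]
  have hC : (cStar b p : ℤ) ≤ 6 := by exact_mod_cast cStar_le_six_A6u7 hs hA hQ
  have hfd : dOf b / (p : ℤ) < 2 := by rw [Int.ediv_lt_iff_lt_mul hp0]; linarith
  rw [if_neg (by omega)]
  have hmin : -1 ≤ min (0 : ℤ) (5 - (cStar b p : ℤ)) := le_min (by norm_num) (by linarith)
  have hlaw := cas_geA6u7 hb hs hbj hj1 hj7 hprime hp5 hwin hA hA6 hQ hQ17 hF1 hF2 hcas
  by_cases h1 : (p : ℤ) ≤ dOf b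
  · have hfd1 : dOf b / (p : ℤ) ≤ 1 := by omega
    rw [if_pos h1] at hlaw
    linarith
  · rw [if_neg h1] at hlaw
    push Not at h1
    have hd0 : 0 ≤ dOf b := by have := hb.2.2; unfold dOf; linarith
    have hfd0 : dOf b / (p : ℤ) = 0 := Int.ediv_eq_zero_of_lt hd0 h1
    rw [hfd0]
    linarith

/-- **THE NODE ON THIS a = 6 PROFILE AT DEPTH `d < 2p`, EVERY SORTED `b`: `PathAccountingFirstPeriod` with its binders VERBATIM plus `b₇ < p ≤ b₆`, the profile
inequalities and `d < 2p`.** -/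
theorem pathAccountingFirstPeriod_profileA6u7 :
    ∀ (b : ℕ → ℤ) (p : ℕ), InPolytope b → Sorted7 b → InPolytope (shift b 7) →
      p.Prime → 5 ≤ p → (b 0 + 2 : ℤ) < (p : ℤ) ^ 2 → FirstPeriod b p →
      b 7 < (p : ℤ) → (p : ℤ) ≤ b 6 → b 0 < (p : ℤ) + b 5 + b 6 → (p : ℤ) + b 1 + b 7 ≤ b 0 → dOf b < 2 * (p : ℤ) → casoratian b 7 ≠ 0 →
        dOf b / (p : ℤ) - pairFloors b p - min (if 2 ≤ dOf b / (p : ℤ) then (1 : ℤ) else 0) (5 - (cStar b p : ℤ))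
          ≤ padicValRat p (casoratian b 7) :=
  fun b p hb hs hb7 hprime hp5 hwin hfp hA hA6 hQ hQ17 hd2 hcas =>
    pathAccounting_profileA6u7 b 7 p hb hs hb7 (by norm_num) (by norm_num) hprime hp5 hwin hfp hA hA6 hQ hQ17 hd2 hcas

end A6U7

/-! ## The a = 6 profile with long pair blocks `(i,7)`, `i ≤ 6`, and `(5,6)` -/

section A6U67

variable {b : ℕ → ℤ} {j p : ℕ}

/-- **`C⋆ ≤ 7` on this profile** (six long parameters; long pair blocks `(i,7)`, `i ≤ 6`, and `(5,6)`): the finite check over the 5,040 orderings (`decide +kernel`). -/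
theorem cStar_le_seven_A6u67 {b : ℕ → ℤ} {p : ℕ} (hs : Sorted7 b) (hA : b 7 < (p : ℤ)) (hQ : b 0 < (p : ℤ) + b 4 + b 6) : cStar b p ≤ 7 := by
  obtain ⟨h21, h32, h43, h54, h65, h76⟩ := sorted7_chain hs
  refine DenomLaw.FirstPeriodKit.cStar_le_of_profile (fun i => i.val ≤ 5)
    (fun i k => ¬ (((i.val ≤ 5 ∧ k.val ≤ 5) ∧ ¬ (i.val = 4 ∧ k.val = 5) ∧ ¬ (i.val = 5 ∧ k.val = 4)) ∧ i.val ≠ k.val)) 7 ?_ ?_ (by decide +kernel)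
  · intro i h
    have := i.isLt
    by_contra hc
    have h6 : i.val = 6 := by omega
    have : b (i.val + 1) = b 7 := by rw [h6]
    linarith
  · intro i k hik h
    obtain ⟨⟨⟨hi, hk⟩, hn1, hn2⟩, hne⟩ := h
    have := i.isLt; have := k.isLt
    exfalso
    interval_cases hv : i.val <;> interval_cases hw : k.val <;> simp only [Nat.reduceAdd] at hik <;> omega

/-- **The V-GAIN law on this profile, general `b`, every depth**: `v_p(Cas_j(b)) ≥ −5`, and `≥ −4` for `p ≤ d` — the minimum `VB = −6` of
`ν` over the cover's pole types is carried ONLY by the centre-free palindromic single-pole type `[0,−6,0]` (exponent `−6`, even), every other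
pole type has `ν ≥ −5`, and the multipole types have `E ≥ −2` (gen 10's `checkB` at `N = 6` and the row check, `decide`d on the whole type lists);
gen 23's `DenomLaw.vgain_of_cover` (pairwise cancellation of the carriers' constant terms for `b` AND `b + e_j`, THEOREM LB's rows). -/
theorem cas_geA6u67 (hb : InPolytope b) (hs : Sorted7 b) (hbj : InPolytope (shift b j)) (hj1 : 1 ≤ j) (hj7 : j ≤ 7)
    (hprime : p.Prime) (hp5 : 5 ≤ p) (hwin : (b 0 + 2 : ℤ) < (p : ℤ) ^ 2) (hA : b 7 < (p : ℤ)) (hA6 : (p : ℤ) ≤ b 6) (hQ : b 0 < (p : ℤ) + b 4 + b 6) (hQ17 : (p : ℤ) + b 1 + b 7 ≤ b 0) (hQ56 : (p : ℤ) + b 5 + b 6 ≤ b 0)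
    (hF1 : b 1 < 2 * (p : ℤ)) (hF2 : b 0 < 2 * (p : ℤ) + b 6 + b 7) (hcas : casoratian b j ≠ 0) :
    -5 + (if (p : ℤ) ≤ dOf b then (1 : ℤ) else 0) ≤ padicValRat p (casoratian b j) := by
  haveI : Fact p.Prime := ⟨hprime⟩
  have hp2 : p % 2 = 1 := Nat.odd_iff.1 (hprime.odd_of_ne_two (by omega))
  obtain ⟨h21, h32, h43, h54, h65, h76⟩ := sorted7_chain hs
  obtain ⟨h0, hb1, hb2, hb3, hb4, hb5, hb6, hb7, hc1⟩ := box hb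
  have hpb : (p : ℤ) ≤ b 0 := by linarith
  have hmin : min (1 : ℤ) 0 = 0 := by norm_num
  rcases Int.emod_two_eq_zero_or_one (b 0) with hr | hr
  · have h := vgain_of_cover hb hj1 hj7 hbj hp5 hpb hwin (coverA6u67_ev hb hs hA hA6 hQ hQ17 hQ56 hF1 hF2 hp5 hp2 hr) (N := 6) (by norm_num) ⟨3, rfl⟩
      (by rw [oddFlag_false hr]; decide) 1 le_rfl (by rw [oddFlag_false hr]; decide) hcas
    rw [hmin] at h; push_cast at h; linarith
  · have h := vgain_of_cover hb hj1 hj7 hbj hp5 hpb hwin (coverA6u67_od hb hs hA hA6 hQ hQ17 hQ56 hF1 hF2 hp5 hp2 hr) (N := 6) (by norm_num) ⟨3, rfl⟩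
      (by rw [oddFlag_true hr]; decide) 1 le_rfl (by rw [oddFlag_true hr]; decide) hcas
    rw [hmin] at h; push_cast at h; linarith

/-- **`PathAccountingFirstPeriod`'s conclusion on this a = 6 profile (long pair blocks `(i,7)`, `i ≤ 6`, and `(5,6)`), EVERY sorted `b`, every direction `j`, depth `d < 2p`**
(`N_p = 7`, `C⋆ ≤ 7`; the node asks `-5` at `⌊d/p⌋ = 0` and `-4` at `⌊d/p⌋ = 1`; the depth `⌊d/p⌋ = 2` — 145 resp. 36 of the 7,427 resp. 2,307 instances
at p = 7 — is NOT covered here: there the node asks `−3` and the census reaches it by (CV+) / the ZERO-V rungs). -/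
theorem pathAccounting_profileA6u67 (b : ℕ → ℤ) (j p : ℕ) (hb : InPolytope b) (hs : Sorted7 b) (hbj : InPolytope (shift b j))
    (hj1 : 1 ≤ j) (hj7 : j ≤ 7) (hprime : p.Prime) (hp5 : 5 ≤ p) (hwin : (b 0 + 2 : ℤ) < (p : ℤ) ^ 2) (hfp : FirstPeriod b p)
    (hA : b 7 < (p : ℤ)) (hA6 : (p : ℤ) ≤ b 6) (hQ : b 0 < (p : ℤ) + b 4 + b 6) (hQ17 : (p : ℤ) + b 1 + b 7 ≤ b 0) (hQ56 : (p : ℤ) + b 5 + b 6 ≤ b 0) (hd2 : dOf b < 2 * (p : ℤ))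
    (hcas : casoratian b j ≠ 0) :
    dOf b / (p : ℤ) - pairFloors b p - min (if 2 ≤ dOf b / (p : ℤ) then (1 : ℤ) else 0) (5 - (cStar b p : ℤ))
      ≤ padicValRat p (casoratian b j) := by
  obtain ⟨hF1, hF2⟩ := fp_bounds hfp
  have hp0 : (0 : ℤ) < p := by exact_mod_cast hprime.pos
  rw [pairFloors_eq_7a hb hs hprime.pos hQ hQ17 hQ56 hfp]
  have hC : (cStar b p : ℤ) ≤ 7 := by exact_mod_cast cStar_le_seven_A6u67 hs hA hQ
  have hfd : dOf b / (p : ℤ) < 2 := by rw [Int.ediv_lt_iff_lt_mul hp0]; linarith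
  rw [if_neg (by omega)]
  have hmin : -2 ≤ min (0 : ℤ) (5 - (cStar b p : ℤ)) := le_min (by norm_num) (by linarith)
  have hlaw := cas_geA6u67 hb hs hbj hj1 hj7 hprime hp5 hwin hA hA6 hQ hQ17 hQ56 hF1 hF2 hcas
  by_cases h1 : (p : ℤ) ≤ dOf b
  · have hfd1 : dOf b / (p : ℤ) ≤ 1 := by omega
    rw [if_pos h1] at hlaw
    linarith
  · rw [if_neg h1] at hlaw
    push Not at h1
    have hd0 : 0 ≤ dOf b := by have := hb.2.2; unfold dOf; linarith
    have hfd0 : dOf b / (p : ℤ) = 0 := Int.ediv_eq_zero_of_lt hd0 h1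
    rw [hfd0]
    linarith

/-- **THE NODE ON THIS a = 6 PROFILE AT DEPTH `d < 2p`, EVERY SORTED `b`: `PathAccountingFirstPeriod` with its binders VERBATIM plus `b₇ < p ≤ b₆`, the profile
inequalities and `d < 2p`.** -/
theorem pathAccountingFirstPeriod_profileA6u67 :
    ∀ (b : ℕ → ℤ) (p : ℕ), InPolytope b → Sorted7 b → InPolytope (shift b 7) →
      p.Prime → 5 ≤ p → (b 0 + 2 : ℤ) < (p : ℤ) ^ 2 → FirstPeriod b p →
      b 7 < (p : ℤ) → (p : ℤ) ≤ b 6 → b 0 < (p : ℤ) + b 4 + b 6 → (p : ℤ) + b 1 + b 7 ≤ b 0 → (p : ℤ) + b 5 + b 6 ≤ b 0 → dOf b < 2 * (p : ℤ) → casoratian b 7 ≠ 0 →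
        dOf b / (p : ℤ) - pairFloors b p - min (if 2 ≤ dOf b / (p : ℤ) then (1 : ℤ) else 0) (5 - (cStar b p : ℤ))
          ≤ padicValRat p (casoratian b 7) :=
  fun b p hb hs hb7 hprime hp5 hwin hfp hA hA6 hQ hQ17 hQ56 hd2 hcas =>
    pathAccounting_profileA6u67 b 7 p hb hs hb7 (by norm_num) (by norm_num) hprime hp5 hwin hfp hA hA6 hQ hQ17 hQ56 hd2 hcas

end A6U67

end Summit.KontsevichZagierPeriods.Zeta5Search.FullProfile
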